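import Literature.NumberTheory.Automorphic.ArchRankOneCasimirRadialEquation       -- ★ Z3(b) p844004: `sin²ψ•(O_Ω+O″) + 2 sinψ cosψ•O′ = 0`, `HasDerivAt O O′`, `HasDerivAt O′ O″`
import Literature.NumberTheory.Automorphic.ArchRankOneLimitFormulaGroup            -- ★ (R1G) p840661: `exists_tendsto_deriv_two_sin_smul_orbitalIntegral`
import HarnessLib

/-!
# The THIRD jet of Harish-Chandra's normalised orbital integral on `U(e₀,e₁)` (`e₀e₁ < 0`):
# `F_f″ = −F_f − F_{Ωf}` on `0 < |ψ| < 1` and `lim_{ψ→0, ψ≠0} F_f‴(ψ) = −C·(f + Ωf)(z·1)` (Varadarajan 1989 §6.4 Thm 24, `r = 1`)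

Topic `NumberTheory/Automorphic`; namespace `Literature.NumberTheory.Automorphic.RankOneCasimir`.  THEOREMS ONLY (no `def`, no instance, no notation, no axiom, no named
fact, no `sorry`).  Cell `pub/hodgecm-mathlib`, ENGINE T1 (crux H413 = `stmt-HodgeConjecture-24833`); ROAD (Z) toward the row (J3-odd)₃ = [Varadarajan1989 §6.4 Thm 24, `r = 1`]
descended (census `CENSUS-J3odd3-InHouse.A-p18g25.md` 7db511ac), FILE Z4 of five, over ★ Z3 (`ArchRankOneCasimirRadialEquation`, `…BoostJets`) and ★ (R1G)
(`ArchRankOneLimitFormulaGroup`).  Author A-p18 (g26), 2026-09-01.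

SETTING (the (R1G) ∕ (d3a) spelling, so that FILE Z5 plugs in at the block group of the noncompact wall): `L` a field with a complex place `w`, `a : Fin 2 → L` with `a_i ≠ 0`,
`e_i = σ_w a_i` real, `e₀e₁ < 0` encoded by reals `p, q` with `pq = 1`, `q²e₁ = −e₀`; `G₂ = unitaryGroupOfForm (starRingEnd ℂ) ((diag a).map σ_w)` (`= archLocal L 2 (diag a) w` by `rfl`;
the instances are bridged inside the proofs); `μ` a Haar measure on `G₂` which is also RIGHT-invariant (`G₂` is unimodular; the CM consumer discharges this with ★
`modularCharacterFun_archLocal_eq_one` + ★ `isMulRightInvariant_of_modularCharacterFun_eq_one`).  For `g : M₂(ℂ) → E` and `z ∈ S¹` the NORMALISED ORBITAL INTEGRAL is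
`F_g(ψ) = 2 sin ψ · ∫_{G₂} g(↑↑(h · t_z(ψ) · h⁻¹)) dμ(h)`, `t_z(ψ) = diag(z e^{iψ}, z e^{−iψ})` — EXACTLY ★ (R1G)'s function; it enters the statement as a bound functional `F` with
defining hypothesis `hF` (instantiate by `fun _ _ => rfl`).  `Ωf` is the Casimir of `f` (★ Z3: `(Ωf)(Y) = −(D²f(Y)[YX₁]² + Df(Y)[YX₁X₁]) + Σ_{k=2,3}(D²f(Y)[YX̂_k]² + Df(Y)[YX̂_kX̂_k])`),
a bound variable `Ω` with hypothesis `hΩ`.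

WHAT IS PROVED (`exists_tendsto_iteratedDeriv_three_orbitalIntegral`): there is ONE `C ≠ 0` (★ (R1G)'s, depending on `μ` only) such that for every `f ∈ C³_c(M₂(ℂ), E)`, every `z ∈ S¹`:
* (first jets) `F_f′ → C • f(z·1)` and `F_{Ωf}′ → C • (Ωf)(z·1)` along `𝓝[≠] 0` (★ (R1G) for `f` and for `Ωf ∈ C¹_c`);
* (structure on `0 < |ψ| < 1`) `F_f`, `F_{Ωf}` are differentiable there and **`(F_f′)′(ψ) = −(F_f(ψ) + F_{Ωf}(ψ))`** — the radial equation ★ Z3 `sin²ψ•(O_Ω + O″) + 2 sinψ cosψ•O′ = 0`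
  divided by `sin ψ ≠ 0`, with `F′ = 2cos•O + 2sin•O′`, `F″ = −2sin•O + 4cos•O′ + 2sin•O″` (★ Z3 `hasDerivAt_orbitalIntegral_torusCurve`);
* (third jet) **`iteratedDeriv 3 F_f → −(C • f(z·1) + C • (Ωf)(z·1))` along `𝓝[≠] 0`** (`F‴ = −F′ − F_{Ωf}′` near every `ψ ≠ 0`, then the two first-jet limits).
This is [Varadarajan1989 §6.4 Thm 24] for `r = 1` on `U(1,1)` («the odd-order derivatives of `F_f` are continuous at `0`, `∂³F_f(0) ∝ (Ωf)(1) + …`») in the tree's currency; FILE Z5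
transports it to the letter's `F_Θ = ρ′Δ·Φ_Θ` along the normal line through a semiregular point of the noncompact wall of `U(2,1)` (★ (d3a) averaging + Leibniz with an even
smooth factor).  HONEST LABEL: pays nothing by itself (HC_CM is proved only modulo the printed citations until rung 0 closes).

## References
* [Varadarajan1989] V. S. Varadarajan, *An Introduction to Harmonic Analysis on Semisimple Lie Groups* (1989), §6.4 Thm 24 (and Thm 22, §6.3: `F_{Ωf} = −(F_f″ + F_f)`).
* [Rogawski1990] J. D. Rogawski, *Automorphic Representations of Unitary Groups in Three Variables*, Ann. of Math. Stud. 123 (1990), §8.2 p. 119, §8.4 p. 126.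
* [Folland1995] G. B. Folland, *A Course in Abstract Harmonic Analysis* (1995), §2.6.
-/

set_option autoImplicit false

namespace Literature.NumberTheory.Automorphic.RankOneCasimir

open _root_.Complex _root_.Matrix _root_.MeasureTheory _root_.Set _root_.Filter _root_.Topology _root_.NumberField _root_.NumberField.InfinitePlace
open _root_.Literature.NumberTheory.Automorphic _root_.Literature.NumberTheory.Automorphic.UnitaryGroup
open scoped Matrix.Norms.Operator MatrixGroups ComplexConjugate

variable (L : Type) [Field L] (a : Fin 2 → L) (w : {w : InfinitePlace L // IsComplex w})
variable {E : Type*} [NormedAddCommGroup E] [NormedSpace ℝ E] [CompleteSpace E]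

/-- **THE THIRD JET OF THE NORMALISED ORBITAL INTEGRAL ON `U(e₀,e₁)`, `e₀e₁ < 0`** ([Varadarajan1989 §6.4 Thm 24, `r = 1`] in the tree's currency).  One `C ≠ 0` (★ (R1G)'s) such that
for all `f ∈ C³_c(M₂(ℂ), E)`, its Casimir `Ωf` (bound variable `Ω`, hypothesis `hΩ`), `z ∈ S¹`, and the normalised orbital integrals `F g ψ = 2 sin ψ · ∫ g(↑↑(h t_z(ψ) h⁻¹)) dμ` (bound
functional `F`, hypothesis `hF`): the first jets of `F f`, `F Ω` tend to `C • f(z·1)`, `C • Ω(z·1)` along `𝓝[≠] 0`; on `0 < |ψ| < 1` both are differentiable and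
`(F f)′` has derivative `−(F f ψ + F Ω ψ)`; and `iteratedDeriv 3 (F f) → −(C • f(z·1) + C • Ω(z·1))` along `𝓝[≠] 0`.  Proof: ★ (R1G) twice (for `f` and for `Ω ∈ C¹_c`), ★ Z3
(`hasDerivAt_orbitalIntegral_torusCurve`, `sin_sq_smul_orbital_casimir_add_eq_zero`) on the `archLocal` spelling of `G₂` (instances bridged by `rfl`), the product rule for
`2 sin ψ • O(ψ)`, and `F‴ = (−F − F_Ω)′` near each `ψ ≠ 0`. [cite: Varadarajan1989, §6.4 Thm 24] [cite: Rogawski1990, §8.2 p. 119] -/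
theorem exists_tendsto_iteratedDeriv_three_orbitalIntegral
    (ha : ∀ i, a i ≠ 0) (hreal : ∀ i, (w.1.embedding (a i)).im = 0) (hsgn : (w.1.embedding (a 0)).re * (w.1.embedding (a 1)).re < 0)
    {p q : ℝ} (hpq : p * q = 1) (hqe : (q : ℂ) ^ 2 * w.1.embedding (a 1) = -w.1.embedding (a 0))
    [MeasurableSpace (unitaryGroupOfForm (starRingEnd ℂ) ((Matrix.diagonal a).map w.1.embedding))]
    [BorelSpace (unitaryGroupOfForm (starRingEnd ℂ) ((Matrix.diagonal a).map w.1.embedding))]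
    (μ : Measure (unitaryGroupOfForm (starRingEnd ℂ) ((Matrix.diagonal a).map w.1.embedding))) [μ.IsHaarMeasure] [μ.IsMulRightInvariant] :
    ∃ C : ℝ, C ≠ 0 ∧ ∀ (f : Matrix (Fin 2) (Fin 2) ℂ → E), ContDiff ℝ 3 f → HasCompactSupport f →
      ∀ (Ω : Matrix (Fin 2) (Fin 2) ℂ → E), (∀ Y : Matrix (Fin 2) (Fin 2) ℂ, Ω Y =
        -(fderiv ℝ (fderiv ℝ f) Y (Y * !![I, 0; 0, -I]) (Y * !![I, 0; 0, -I]) + fderiv ℝ f Y (Y * !![I, 0; 0, -I] * !![I, 0; 0, -I])) +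
          (fderiv ℝ (fderiv ℝ f) Y (Y * !![(0 : ℂ), (p : ℂ); (q : ℂ), 0]) (Y * !![(0 : ℂ), (p : ℂ); (q : ℂ), 0]) +
            fderiv ℝ f Y (Y * !![(0 : ℂ), (p : ℂ); (q : ℂ), 0] * !![(0 : ℂ), (p : ℂ); (q : ℂ), 0])) +
          (fderiv ℝ (fderiv ℝ f) Y (Y * !![(0 : ℂ), -((p : ℂ) * I); (q : ℂ) * I, 0]) (Y * !![(0 : ℂ), -((p : ℂ) * I); (q : ℂ) * I, 0]) +
            fderiv ℝ f Y (Y * !![(0 : ℂ), -((p : ℂ) * I); (q : ℂ) * I, 0] * !![(0 : ℂ), -((p : ℂ) * I); (q : ℂ) * I, 0]))) →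
      ∀ (z : Circle) (F : (Matrix (Fin 2) (Fin 2) ℂ → E) → ℝ → E), (∀ (g : Matrix (Fin 2) (Fin 2) ℂ → E) (ψ : ℝ), F g ψ = (2 * Real.sin ψ) •
        ∫ h : unitaryGroupOfForm (starRingEnd ℂ) ((Matrix.diagonal a).map w.1.embedding),
          g (((h * ⟨circleDiagonal 2 ![z * Circle.exp ψ, z * Circle.exp (-ψ)], circleDiagonal_mem_archLocal_diagonal L 2 a w _⟩ * h⁻¹ :
            unitaryGroupOfForm (starRingEnd ℂ) ((Matrix.diagonal a).map w.1.embedding)) : GL (Fin 2) ℂ) : Matrix (Fin 2) (Fin 2) ℂ) ∂μ) →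
      Tendsto (fun ψ : ℝ => deriv (F f) ψ) (𝓝[≠] 0) (𝓝 (C • f ((z : ℂ) • (1 : Matrix (Fin 2) (Fin 2) ℂ)))) ∧
      Tendsto (fun ψ : ℝ => deriv (F Ω) ψ) (𝓝[≠] 0) (𝓝 (C • Ω ((z : ℂ) • (1 : Matrix (Fin 2) (Fin 2) ℂ)))) ∧
      (∀ ψ ∈ Ioo (-1 : ℝ) 1, ψ ≠ 0 →
        HasDerivAt (F f) (deriv (F f) ψ) ψ ∧ HasDerivAt (F Ω) (deriv (F Ω) ψ) ψ ∧ HasDerivAt (deriv (F f)) (-(F f ψ + F Ω ψ)) ψ) ∧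
      Tendsto (fun ψ : ℝ => iteratedDeriv 3 (F f) ψ) (𝓝[≠] 0)
        (𝓝 (-(C • f ((z : ℂ) • (1 : Matrix (Fin 2) (Fin 2) ℂ)) + C • Ω ((z : ℂ) • (1 : Matrix (Fin 2) (Fin 2) ℂ))))) := by
  -- ★ (R1G): the constant `C` and the first-jet limit for every `C¹_c` test function
  obtain ⟨C, hC, hR⟩ := exists_tendsto_deriv_two_sin_smul_orbitalIntegral (E := E) w.1.embedding a hreal hsgn μ
  refine ⟨C, hC, fun f hf hfc Ω hΩ z F hF => ?_⟩
  -- bridge the instances to the `archLocal L 2 (diag a) w` spelling of ★ Z3 (`rfl`)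
  have hfin : IsFiniteMeasureOnCompacts μ := inferInstance
  have hri : μ.IsMulRightInvariant := inferInstance
  letI iA : MeasurableSpace (archLocal L 2 (Matrix.diagonal a) w) :=
    ‹MeasurableSpace (unitaryGroupOfForm (starRingEnd ℂ) ((Matrix.diagonal a).map w.1.embedding))›
  haveI : BorelSpace (archLocal L 2 (Matrix.diagonal a) w) := ‹BorelSpace (unitaryGroupOfForm (starRingEnd ℂ) ((Matrix.diagonal a).map w.1.embedding))›
  haveI : @IsFiniteMeasureOnCompacts (archLocal L 2 (Matrix.diagonal a) w) iA _ μ := hfin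
  haveI : @Measure.IsMulRightInvariant (archLocal L 2 (Matrix.diagonal a) w) iA _ μ := hri
  -- regularity of `f` and of `Ωf`
  have hf1 : ContDiff ℝ 1 f := hf.of_le (by norm_num)
  have hf2 : ContDiff ℝ 2 f := hf.of_le (by norm_num)
  have hD2 := (hf.fderiv_right (m := 2) (by norm_num)).fderiv_right (m := 1) (by norm_num)
  have hD1 := hf.fderiv_right (m := 1) (by norm_num)
  have hB : ∀ X : Matrix (Fin 2) (Fin 2) ℂ, ContDiff ℝ 1 fun Y : Matrix (Fin 2) (Fin 2) ℂ => fderiv ℝ (fderiv ℝ f) Y (Y * X) (Y * X) := fun X =>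
    (hD2.clm_apply (contDiff_id.mul contDiff_const)).clm_apply (contDiff_id.mul contDiff_const)
  have hl : ∀ X : Matrix (Fin 2) (Fin 2) ℂ, ContDiff ℝ 1 fun Y : Matrix (Fin 2) (Fin 2) ℂ => fderiv ℝ f Y (Y * X * X) := fun X =>
    hD1.clm_apply ((contDiff_id.mul contDiff_const).mul contDiff_const)
  have hΩ1 : ContDiff ℝ 1 Ω := by
    rw [funext hΩ]
    exact (((hB _).add (hl _)).neg.add ((hB _).add (hl _))).add ((hB _).add (hl _))
  have hΩc : HasCompactSupport Ω := by
    refine HasCompactSupport.intro hfc fun Y hY => ?_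
    obtain ⟨-, h1, h2⟩ := ConjugationCurve.eq_zero_of_notMem_tsupport f hY
    rw [hΩ, h1, h2]
    simp
  obtain ⟨hRf, hRfd⟩ := hR f hf1 hfc z
  obtain ⟨hRΩ, hRΩd⟩ := hR Ω hΩ1 hΩc z
  -- the orbital integrals of ★ Z3 in the `archLocal` spelling
  obtain ⟨M, hM⟩ : ∃ M : ℝ → Matrix (Fin 2) (Fin 2) ℂ, ∀ ψ : ℝ, M ψ = Matrix.diagonal ![(z : ℂ) * cexp (ψ * I), (z : ℂ) * cexp (-(ψ * I))] :=
    ⟨_, fun _ => rfl⟩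
  obtain ⟨O, hO⟩ : ∃ O : ℝ → E, ∀ ψ : ℝ, O ψ = ∫ h : archLocal L 2 (Matrix.diagonal a) w,
      f (((h : GL (Fin 2) ℂ) : Matrix (Fin 2) (Fin 2) ℂ) * M ψ * (((h⁻¹ : archLocal L 2 (Matrix.diagonal a) w) : GL (Fin 2) ℂ) : Matrix (Fin 2) (Fin 2) ℂ)) ∂μ :=
    ⟨_, fun _ => rfl⟩
  obtain ⟨O', hO'⟩ : ∃ O' : ℝ → E, ∀ ψ : ℝ, O' ψ = ∫ h : archLocal L 2 (Matrix.diagonal a) w,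
      fderiv ℝ f (((h : GL (Fin 2) ℂ) : Matrix (Fin 2) (Fin 2) ℂ) * M ψ * (((h⁻¹ : archLocal L 2 (Matrix.diagonal a) w) : GL (Fin 2) ℂ) : Matrix (Fin 2) (Fin 2) ℂ))
        (((h : GL (Fin 2) ℂ) : Matrix (Fin 2) (Fin 2) ℂ) * (M ψ * !![I, 0; 0, -I]) * (((h⁻¹ : archLocal L 2 (Matrix.diagonal a) w) : GL (Fin 2) ℂ) : Matrix (Fin 2) (Fin 2) ℂ)) ∂μ :=
    ⟨_, fun _ => rfl⟩
  obtain ⟨O'', hO''⟩ : ∃ O'' : ℝ → E, ∀ ψ : ℝ, O'' ψ = ∫ h : archLocal L 2 (Matrix.diagonal a) w,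
      (fderiv ℝ (fderiv ℝ f) (((h : GL (Fin 2) ℂ) : Matrix (Fin 2) (Fin 2) ℂ) * M ψ * (((h⁻¹ : archLocal L 2 (Matrix.diagonal a) w) : GL (Fin 2) ℂ) : Matrix (Fin 2) (Fin 2) ℂ))
          (((h : GL (Fin 2) ℂ) : Matrix (Fin 2) (Fin 2) ℂ) * (M ψ * !![I, 0; 0, -I]) * (((h⁻¹ : archLocal L 2 (Matrix.diagonal a) w) : GL (Fin 2) ℂ) : Matrix (Fin 2) (Fin 2) ℂ))
          (((h : GL (Fin 2) ℂ) : Matrix (Fin 2) (Fin 2) ℂ) * (M ψ * !![I, 0; 0, -I]) * (((h⁻¹ : archLocal L 2 (Matrix.diagonal a) w) : GL (Fin 2) ℂ) : Matrix (Fin 2) (Fin 2) ℂ)) +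
        fderiv ℝ f (((h : GL (Fin 2) ℂ) : Matrix (Fin 2) (Fin 2) ℂ) * M ψ * (((h⁻¹ : archLocal L 2 (Matrix.diagonal a) w) : GL (Fin 2) ℂ) : Matrix (Fin 2) (Fin 2) ℂ))
          (((h : GL (Fin 2) ℂ) : Matrix (Fin 2) (Fin 2) ℂ) * (M ψ * !![I, 0; 0, -I] * !![I, 0; 0, -I]) *
            (((h⁻¹ : archLocal L 2 (Matrix.diagonal a) w) : GL (Fin 2) ℂ) : Matrix (Fin 2) (Fin 2) ℂ))) ∂μ :=
    ⟨_, fun _ => rfl⟩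
  obtain ⟨OΩ, hOΩ⟩ : ∃ OΩ : ℝ → E, ∀ ψ : ℝ, OΩ ψ = ∫ h : archLocal L 2 (Matrix.diagonal a) w,
      Ω (((h : GL (Fin 2) ℂ) : Matrix (Fin 2) (Fin 2) ℂ) * M ψ * (((h⁻¹ : archLocal L 2 (Matrix.diagonal a) w) : GL (Fin 2) ℂ) : Matrix (Fin 2) (Fin 2) ℂ)) ∂μ :=
    ⟨_, fun _ => rfl⟩
  -- the (R1G) functions ARE `2 sin ψ • O(ψ)`, `2 sin ψ • O_Ω(ψ)`
  have hconj : ∀ (h : unitaryGroupOfForm (starRingEnd ℂ) ((Matrix.diagonal a).map w.1.embedding)) (ψ : ℝ),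
      (((h * ⟨circleDiagonal 2 ![z * Circle.exp ψ, z * Circle.exp (-ψ)], circleDiagonal_mem_archLocal_diagonal L 2 a w _⟩ * h⁻¹ :
          unitaryGroupOfForm (starRingEnd ℂ) ((Matrix.diagonal a).map w.1.embedding)) : GL (Fin 2) ℂ) : Matrix (Fin 2) (Fin 2) ℂ) =
        ((h : GL (Fin 2) ℂ) : Matrix (Fin 2) (Fin 2) ℂ) * M ψ * (((h⁻¹ : archLocal L 2 (Matrix.diagonal a) w) : GL (Fin 2) ℂ) : Matrix (Fin 2) (Fin 2) ℂ) :=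
    fun h ψ => by rw [hM]; exact coe_conj_torusPoint L a w h z ψ
  have hFf : F f = fun ψ => (2 * Real.sin ψ) • O ψ := by
    funext ψ; rw [hF, hO]; simp_rw [hconj]; rfl
  have hFΩ : F Ω = fun ψ => (2 * Real.sin ψ) • OΩ ψ := by
    funext ψ; rw [hF, hOΩ]; simp_rw [hconj]; rfl
  -- the first jets (★ (R1G)), restated for the bound functional `F`
  have hFR : F f = fun ψ : ℝ => (2 * Real.sin ψ) • ∫ h : unitaryGroupOfForm (starRingEnd ℂ) ((Matrix.diagonal a).map w.1.embedding),
      f (((h * ⟨circleDiagonal 2 ![z * Circle.exp ψ, z * Circle.exp (-ψ)], circleDiagonal_mem_archLocal_diagonal L 2 a w _⟩ * h⁻¹ : unitaryGroupOfForm (starRingEnd ℂ) ((Matrix.diagonal a).map w.1.embedding)) :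
        GL (Fin 2) ℂ) : Matrix (Fin 2) (Fin 2) ℂ) ∂μ := funext (hF f)
  have hFRΩ : F Ω = fun ψ : ℝ => (2 * Real.sin ψ) • ∫ h : unitaryGroupOfForm (starRingEnd ℂ) ((Matrix.diagonal a).map w.1.embedding),
      Ω (((h * ⟨circleDiagonal 2 ![z * Circle.exp ψ, z * Circle.exp (-ψ)], circleDiagonal_mem_archLocal_diagonal L 2 a w _⟩ * h⁻¹ : unitaryGroupOfForm (starRingEnd ℂ) ((Matrix.diagonal a).map w.1.embedding)) :
        GL (Fin 2) ℂ) : Matrix (Fin 2) (Fin 2) ℂ) ∂μ := funext (hF Ω)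
  have hRf' : Tendsto (fun ψ : ℝ => deriv (F f) ψ) (𝓝[≠] 0) (𝓝 (C • f ((z : ℂ) • (1 : Matrix (Fin 2) (Fin 2) ℂ)))) := by rw [hFR]; exact hRf
  have hRfd' : ∀ ψ ∈ Ioo (-1 : ℝ) 1, ψ ≠ 0 → DifferentiableAt ℝ (F f) ψ := by rw [hFR]; exact hRfd
  have hRΩ' : Tendsto (fun ψ : ℝ => deriv (F Ω) ψ) (𝓝[≠] 0) (𝓝 (C • Ω ((z : ℂ) • (1 : Matrix (Fin 2) (Fin 2) ℂ)))) := by rw [hFRΩ]; exact hRΩ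
  have hRΩd' : ∀ ψ ∈ Ioo (-1 : ℝ) 1, ψ ≠ 0 → DifferentiableAt ℝ (F Ω) ψ := by rw [hFRΩ]; exact hRΩd
  -- on `0 < |ψ| < 1`: `sin ψ ≠ 0`, ★ Z3 gives `O′`, `O″` and the radial equation; product rule + division by `sin ψ`
  have hU : ∀ ψ ∈ Ioo (-1 : ℝ) 1, ψ ≠ 0 → Real.sin ψ ≠ 0 := fun ψ hψ hψ0 hs =>
    hψ0 ((Real.sin_eq_zero_iff_of_lt_of_lt (by linarith [hψ.1, Real.pi_gt_three]) (by linarith [hψ.2, Real.pi_gt_three])).1 hs)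
  have key : ∀ ψ ∈ Ioo (-1 : ℝ) 1, ψ ≠ 0 →
      HasDerivAt (F f) ((2 * Real.sin ψ) • O' ψ + (2 * Real.cos ψ) • O ψ) ψ ∧
        HasDerivAt (fun y : ℝ => (2 * Real.sin y) • O' y + (2 * Real.cos y) • O y) (-(F f ψ + F Ω ψ)) ψ := by
    intro ψ hψ hψ0
    have hsin := hU ψ hψ hψ0
    obtain ⟨-, -, hdO, hdO'⟩ := hasDerivAt_orbitalIntegral_torusCurve L a w μ ha f hf2 hfc z hM hO hO' hO'' hsin
    have hz3 := sin_sq_smul_orbital_casimir_add_eq_zero L a w μ ha hreal hpq hqe f hf2 hfc z hM hΩ hO hO' hO'' hOΩ hsin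
    have h2s : HasDerivAt (fun y : ℝ => 2 * Real.sin y) (2 * Real.cos ψ) ψ := (Real.hasDerivAt_sin ψ).const_mul 2
    have h2c : HasDerivAt (fun y : ℝ => 2 * Real.cos y) (2 * -Real.sin ψ) ψ := (Real.hasDerivAt_cos ψ).const_mul 2
    refine ⟨?_, ?_⟩
    · rw [hFf]; exact h2s.smul hdO
    · have hd : HasDerivAt (fun y : ℝ => (2 * Real.sin y) • O' y + (2 * Real.cos y) • O y)
          ((2 * Real.sin ψ) • O'' ψ + (2 * Real.cos ψ) • O' ψ + ((2 * Real.cos ψ) • O' ψ + (2 * -Real.sin ψ) • O ψ)) ψ :=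
        (h2s.smul hdO').add (h2c.smul hdO)
      have h0 : Real.sin ψ • ((2 * Real.sin ψ) • O'' ψ + (2 * Real.cos ψ) • O' ψ + ((2 * Real.cos ψ) • O' ψ + (2 * -Real.sin ψ) • O ψ) +
          ((2 * Real.sin ψ) • O ψ + (2 * Real.sin ψ) • OΩ ψ)) = 0 := by
        linear_combination (norm := module) (2 : ℝ) • hz3
      have h1 := eq_neg_of_add_eq_zero_left ((smul_eq_zero.1 h0).resolve_left hsin)
      have hval : -(F f ψ + F Ω ψ) = (2 * Real.sin ψ) • O'' ψ + (2 * Real.cos ψ) • O' ψ + ((2 * Real.cos ψ) • O' ψ + (2 * -Real.sin ψ) • O ψ) := by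
        rw [h1, hFf, hFΩ]
      rw [hval]; exact hd
  have hd1 : ∀ ψ ∈ Ioo (-1 : ℝ) 1, ψ ≠ 0 → deriv (F f) ψ = (2 * Real.sin ψ) • O' ψ + (2 * Real.cos ψ) • O ψ := fun ψ hψ hψ0 => (key ψ hψ hψ0).1.deriv
  have hd2 : ∀ ψ ∈ Ioo (-1 : ℝ) 1, ψ ≠ 0 → HasDerivAt (deriv (F f)) (-(F f ψ + F Ω ψ)) ψ := fun ψ hψ hψ0 => by
    have hev : deriv (F f) =ᶠ[𝓝 ψ] fun y : ℝ => (2 * Real.sin y) • O' y + (2 * Real.cos y) • O y := by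
      filter_upwards [isOpen_Ioo.mem_nhds hψ, isOpen_ne.mem_nhds hψ0] with y hy hy0
      exact hd1 y hy hy0
    exact (key ψ hψ hψ0).2.congr_of_eventuallyEq hev
  refine ⟨hRf', hRΩ', fun ψ hψ hψ0 => ⟨(hRfd' ψ hψ hψ0).hasDerivAt, (hRΩd' ψ hψ hψ0).hasDerivAt, hd2 ψ hψ hψ0⟩, ?_⟩
  -- the third jet: `F‴ = −(F′ + F_Ω′)` near every `ψ` with `0 < |ψ| < 1`, then the two first-jet limits
  have h3 : ∀ ψ ∈ Ioo (-1 : ℝ) 1, ψ ≠ 0 → iteratedDeriv 3 (F f) ψ = -(deriv (F f) ψ + deriv (F Ω) ψ) := fun ψ hψ hψ0 => by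
    have hev : deriv (deriv (F f)) =ᶠ[𝓝 ψ] fun y : ℝ => -(F f y + F Ω y) := by
      filter_upwards [isOpen_Ioo.mem_nhds hψ, isOpen_ne.mem_nhds hψ0] with y hy hy0
      exact (hd2 y hy hy0).deriv
    rw [iteratedDeriv_succ, iteratedDeriv_succ, iteratedDeriv_one, hev.deriv_eq, deriv.fun_neg, deriv_fun_add (hRfd' ψ hψ hψ0) (hRΩd' ψ hψ hψ0)]
  have hmem : Ioo (-1 : ℝ) 1 ∩ {(0 : ℝ)}ᶜ ∈ 𝓝[≠] (0 : ℝ) :=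
    inter_mem (mem_nhdsWithin_of_mem_nhds (Ioo_mem_nhds (by norm_num) (by norm_num))) self_mem_nhdsWithin
  refine ((hRf'.add hRΩ').neg).congr' ?_
  filter_upwards [hmem] with ψ hψ
  exact (h3 ψ hψ.1 hψ.2).symm


omit [CompleteSpace E] in
/-- **Boundedness near `0` from a limit of the derivative** (mean value theorem on each side): if `F` is differentiable on `0 < |ψ| < 1` and `F′` has a limit along `𝓝[≠] 0`, then
`‖F‖` is bounded on a punctured neighbourhood of `0` (the one-sided limits of `F` may differ — `F_f` JUMPS at `0` — but both exist).  FILE Z5 uses it for `F_f` and `F_{Ωf}`, hence for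
`F_f″ = −F_f − F_{Ωf}`, in the Leibniz expansion of `(ρ′Δ·Φ_Θ)‴` whose coefficients `κ′(0) = κ‴(0) = 0` vanish. [cite: Varadarajan1989, §6.4 Thm 22] -/
theorem exists_eventually_norm_le_of_tendsto_deriv {F : ℝ → E} {L' : E} (hd : ∀ ψ ∈ Ioo (-1 : ℝ) 1, ψ ≠ 0 → DifferentiableAt ℝ F ψ)
    (hL : Tendsto (fun ψ : ℝ => deriv F ψ) (𝓝[≠] 0) (𝓝 L')) :
    ∃ B : ℝ, ∀ᶠ ψ in 𝓝[≠] (0 : ℝ), ‖F ψ‖ ≤ B := by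
  -- a punctured ball on which `‖F′‖ ≤ ‖L′‖ + 1`
  have hev : ∀ᶠ ψ in 𝓝[≠] (0 : ℝ), ‖deriv F ψ‖ ≤ ‖L'‖ + 1 := by
    filter_upwards [hL (Metric.closedBall_mem_nhds L' one_pos)] with ψ hψ
    exact norm_le_norm_add_const_of_dist_le (Metric.mem_closedBall.1 hψ)
  obtain ⟨ε, hε, hball⟩ := Metric.eventually_nhds_iff_ball.1 (eventually_nhdsWithin_iff.1 hev)
  obtain ⟨δ, hδdef⟩ : ∃ δ : ℝ, δ = min ε 1 := ⟨_, rfl⟩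
  have hδ : 0 < δ := by rw [hδdef]; exact lt_min hε one_pos
  have hδε : δ ≤ ε := by rw [hδdef]; exact min_le_left _ _
  have hδ1 : δ ≤ 1 := by rw [hδdef]; exact min_le_right _ _
  have hreg : ∀ x : ℝ, x ≠ 0 → |x| < δ → DifferentiableAt ℝ F x ∧ ‖deriv F x‖ ≤ ‖L'‖ + 1 := fun x hx0 hxδ =>
    ⟨hd x (mem_Ioo.2 (abs_lt.1 (lt_of_lt_of_le hxδ hδ1))) hx0,
      hball x (by rw [Metric.mem_ball, dist_zero_right, Real.norm_eq_abs]; linarith) hx0⟩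
  -- mean value theorem on `(0, δ)` and on `(−δ, 0)`, anchored at `±δ∕2`
  have hpos : ∀ ψ ∈ Ioo (0 : ℝ) δ, ‖F ψ‖ ≤ ‖F (δ / 2)‖ + (‖L'‖ + 1) * δ := fun ψ hψ => by
    have hs : ∀ x ∈ Ioo (0 : ℝ) δ, x ≠ 0 ∧ |x| < δ := fun x hx => ⟨hx.1.ne', by rw [abs_of_pos hx.1]; exact hx.2⟩
    have hmvt := Convex.norm_image_sub_le_of_norm_deriv_le (fun x hx => (hreg x (hs x hx).1 (hs x hx).2).1)
      (fun x hx => (hreg x (hs x hx).1 (hs x hx).2).2) (convex_Ioo (0 : ℝ) δ) (mem_Ioo.2 ⟨by linarith, by linarith⟩ : δ / 2 ∈ Ioo (0 : ℝ) δ) hψ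
    have hdist : ‖ψ - δ / 2‖ ≤ δ := by rw [Real.norm_eq_abs, abs_le]; constructor <;> linarith [hψ.1, hψ.2]
    calc ‖F ψ‖ ≤ ‖F (δ / 2)‖ + ‖F ψ - F (δ / 2)‖ := norm_le_norm_add_norm_sub' _ _
      _ ≤ ‖F (δ / 2)‖ + (‖L'‖ + 1) * δ := by gcongr; exact hmvt.trans (by gcongr)
  have hneg : ∀ ψ ∈ Ioo (-δ) (0 : ℝ), ‖F ψ‖ ≤ ‖F (-(δ / 2))‖ + (‖L'‖ + 1) * δ := fun ψ hψ => by
    have hs : ∀ x ∈ Ioo (-δ) (0 : ℝ), x ≠ 0 ∧ |x| < δ := fun x hx => ⟨hx.2.ne, by rw [abs_of_neg hx.2]; linarith [hx.1]⟩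
    have hmvt := Convex.norm_image_sub_le_of_norm_deriv_le (fun x hx => (hreg x (hs x hx).1 (hs x hx).2).1)
      (fun x hx => (hreg x (hs x hx).1 (hs x hx).2).2) (convex_Ioo (-δ) (0 : ℝ)) (mem_Ioo.2 ⟨by linarith, by linarith⟩ : -(δ / 2) ∈ Ioo (-δ) (0 : ℝ)) hψ
    have hdist : ‖ψ - -(δ / 2)‖ ≤ δ := by rw [Real.norm_eq_abs, abs_le]; constructor <;> linarith [hψ.1, hψ.2]
    calc ‖F ψ‖ ≤ ‖F (-(δ / 2))‖ + ‖F ψ - F (-(δ / 2))‖ := norm_le_norm_add_norm_sub' _ _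
      _ ≤ ‖F (-(δ / 2))‖ + (‖L'‖ + 1) * δ := by gcongr; exact hmvt.trans (by gcongr)
  refine ⟨max ‖F (δ / 2)‖ ‖F (-(δ / 2))‖ + (‖L'‖ + 1) * δ, ?_⟩
  filter_upwards [inter_mem (mem_nhdsWithin_of_mem_nhds (Metric.ball_mem_nhds (0 : ℝ) hδ)) self_mem_nhdsWithin] with ψ hψ
  have hψδ : |ψ| < δ := by have h := hψ.1; rwa [Metric.mem_ball, dist_zero_right, Real.norm_eq_abs] at h
  rcases lt_or_gt_of_ne (show ψ ≠ 0 from hψ.2) with hlt | hgt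
  · exact (hneg ψ ⟨by linarith [neg_abs_le ψ, abs_of_neg hlt], hlt⟩).trans (by gcongr; exact le_max_right _ _)
  · exact (hpos ψ ⟨hgt, by linarith [le_abs_self ψ]⟩).trans (by gcongr; exact le_max_left _ _)

/-- **THE JET PACKAGE FOR FILE Z5** (values and the auxiliary `p, q, Ω` hidden).  For `f ∈ C³_c(M₂(ℂ), E)`, `z ∈ S¹` and the normalised orbital integral `F = F_f` (bound variable, hypothesis
`hF`) on `U(e₀,e₁)`, `e₀e₁ < 0`: there are a companion `G = F_{Ωf}` and limits `L₁, L₁′, L₃` with `F′ → L₁`, `G′ → L₁′`, `F‴ → L₃` along `𝓝[≠] 0`, and on `0 < |ψ| < 1` the functions `F`, `G`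
are differentiable with `(F′)′(ψ) = −(F ψ + G ψ)`.  (= `exists_tendsto_iteratedDeriv_three_orbitalIntegral` with `q = √(−e₀∕e₁)`, `p = q⁻¹`.) [cite: Varadarajan1989, §6.4 Thm 24] -/
theorem exists_jets_orbitalIntegral
    (ha : ∀ i, a i ≠ 0) (hreal : ∀ i, (w.1.embedding (a i)).im = 0) (hsgn : (w.1.embedding (a 0)).re * (w.1.embedding (a 1)).re < 0)
    [MeasurableSpace (unitaryGroupOfForm (starRingEnd ℂ) ((Matrix.diagonal a).map w.1.embedding))] [BorelSpace (unitaryGroupOfForm (starRingEnd ℂ) ((Matrix.diagonal a).map w.1.embedding))] (μ : Measure (unitaryGroupOfForm (starRingEnd ℂ) ((Matrix.diagonal a).map w.1.embedding))) [μ.IsHaarMeasure] [μ.IsMulRightInvariant]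
    (f : Matrix (Fin 2) (Fin 2) ℂ → E) (hf : ContDiff ℝ 3 f) (hfc : HasCompactSupport f) (z : Circle)
    {F : ℝ → E} (hF : ∀ ψ : ℝ, F ψ = (2 * Real.sin ψ) • ∫ h : unitaryGroupOfForm (starRingEnd ℂ) ((Matrix.diagonal a).map w.1.embedding),
      f (((h * ⟨circleDiagonal 2 ![z * Circle.exp ψ, z * Circle.exp (-ψ)], circleDiagonal_mem_archLocal_diagonal L 2 a w _⟩ * h⁻¹ : unitaryGroupOfForm (starRingEnd ℂ) ((Matrix.diagonal a).map w.1.embedding)) :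
        GL (Fin 2) ℂ) : Matrix (Fin 2) (Fin 2) ℂ) ∂μ) :
    ∃ (G : ℝ → E) (L₁ L₁' L₃ : E), Tendsto (fun ψ : ℝ => deriv F ψ) (𝓝[≠] 0) (𝓝 L₁) ∧ Tendsto (fun ψ : ℝ => deriv G ψ) (𝓝[≠] 0) (𝓝 L₁') ∧
      Tendsto (fun ψ : ℝ => iteratedDeriv 3 F ψ) (𝓝[≠] 0) (𝓝 L₃) ∧
      ∀ ψ ∈ Ioo (-1 : ℝ) 1, ψ ≠ 0 → HasDerivAt F (deriv F ψ) ψ ∧ HasDerivAt G (deriv G ψ) ψ ∧ HasDerivAt (deriv F) (-(F ψ + G ψ)) ψ := by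
  -- `q = √(−e₀∕e₁)`, `p = q⁻¹`
  have he₁ : (w.1.embedding (a 1)).re ≠ 0 := fun h => by rw [h, mul_zero] at hsgn; exact lt_irrefl _ hsgn
  have hquot : 0 < -(w.1.embedding (a 0)).re / (w.1.embedding (a 1)).re := by
    rcases lt_or_gt_of_ne he₁ with h | h
    · exact div_pos_of_neg_of_neg (by nlinarith) h
    · exact div_pos (by nlinarith) h
  obtain ⟨q, hqdef⟩ : ∃ q : ℝ, q = Real.sqrt (-(w.1.embedding (a 0)).re / (w.1.embedding (a 1)).re) := ⟨_, rfl⟩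
  have hq2 : q ^ 2 = -(w.1.embedding (a 0)).re / (w.1.embedding (a 1)).re := by rw [hqdef]; exact Real.sq_sqrt hquot.le
  have hq0 : q ≠ 0 := by rw [hqdef]; exact (Real.sqrt_pos.2 hquot).ne'
  have hpq : q⁻¹ * q = 1 := inv_mul_cancel₀ hq0
  have hqe : (q : ℂ) ^ 2 * w.1.embedding (a 1) = -w.1.embedding (a 0) := by
    rw [show ((q : ℂ)) ^ 2 = ((q ^ 2 : ℝ) : ℂ) by push_cast; ring]
    apply Complex.ext
    · rw [Complex.re_ofReal_mul, Complex.neg_re, hq2]; field_simp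
    · rw [Complex.im_ofReal_mul, Complex.neg_im, hreal 1, hreal 0]; simp
  obtain ⟨C, -, h⟩ := exists_tendsto_iteratedDeriv_three_orbitalIntegral (E := E) L a w ha hreal hsgn hpq hqe μ
  obtain ⟨h1, h2, h3, h4⟩ := h f hf hfc _ (fun _ => rfl) z (fun (g : Matrix (Fin 2) (Fin 2) ℂ → E) (ψ : ℝ) => (2 * Real.sin ψ) • ∫ h : unitaryGroupOfForm (starRingEnd ℂ) ((Matrix.diagonal a).map w.1.embedding),
      g (((h * ⟨circleDiagonal 2 ![z * Circle.exp ψ, z * Circle.exp (-ψ)], circleDiagonal_mem_archLocal_diagonal L 2 a w _⟩ * h⁻¹ : unitaryGroupOfForm (starRingEnd ℂ) ((Matrix.diagonal a).map w.1.embedding)) :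
        GL (Fin 2) ℂ) : Matrix (Fin 2) (Fin 2) ℂ) ∂μ) (fun _ _ => rfl)
  have hFeq : F = fun ψ : ℝ => (2 * Real.sin ψ) • ∫ h : unitaryGroupOfForm (starRingEnd ℂ) ((Matrix.diagonal a).map w.1.embedding),
      f (((h * ⟨circleDiagonal 2 ![z * Circle.exp ψ, z * Circle.exp (-ψ)], circleDiagonal_mem_archLocal_diagonal L 2 a w _⟩ * h⁻¹ : unitaryGroupOfForm (starRingEnd ℂ) ((Matrix.diagonal a).map w.1.embedding)) :
        GL (Fin 2) ℂ) : Matrix (Fin 2) (Fin 2) ℂ) ∂μ := funext hF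
  subst hFeq
  exact ⟨_, _, _, _, h1, h2, h4, h3⟩

end Literature.NumberTheory.Automorphic.RankOneCasimir
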